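import Summits.AtomisticToContinuum.BoseEinsteinCondensation.Theorems.BECSubharmonicContinuationCoreDeficitBoundsKernelBall
import Mathlib.MeasureTheory.Integral.IntervalIntegral.FundThmCalculus
import Mathlib.Analysis.SpecialFunctions.Integrals.Basic
import HarnessLib

/-!
# Route `BECSubharmonicContinuation` — the ball Green kernel against plane waves, I: slices
# (helper for `CoreContinuation`, stmt-AtomisticToContinuum-14570)

The Green kernel of the ball `B_S ⊂ ℝ³` for the Laplacian with the uniform measure as source,
`K_S(s) = (4π)⁻¹ (1/s - 3/(2S) + s²/(2S³))` (`-ΔK_S = δ₀ - |B_S|⁻¹ 1_{B_S}`, `K_S = ∂ₙK_S = 0` on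
the sphere `s = S`), is the kernel of the harmonic-minorant step of the route
(`HarmonicMinorant`: `1 - ⨍_{B_S} G = ∫_{B_S} H K_S` with `H = -ΔG`). This file reduces the two
ball integrals of an AXIAL plane wave `cos(κ y₂)` — against `4πK_S(|y|)` and against `1` — to
one-variable integrals over the height `t = y₂`, by Fubini in the cylindrical variables
`ℝ³ = ℝ × ℝ²` (`Literature.Analysis.FluidPDE.cylSplit`) and planar radial integration on the
horizontal discs (`integral_fun_norm_two`):

* `integral_ball_cos_axial_mul_ballKernel`:
  `∫_{B_S} cos(κy₂)(1/|y| - 3/(2S) + |y|²/(2S³)) dy = 2π ∫_{-S}^{S} cos(κt) V(t) dt`,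
  `V(t) = (S - |t|) - (3/(4S))(S² - t²) + (S⁴ - t⁴)/(8S³)` (the disc integral of the kernel at
  height `t`, `integral_radial_slice_ballKernel`: antiderivative
  `√(ρ²+t²) - 3(ρ²+t²)/(4S) + (ρ²+t²)²/(8S³)` in the planar radius `ρ`);
* `integral_ball_cos_axial`: `∫_{B_S} cos(κy₂) dy = ∫_{-S}^{S} cos(κt) π(S² - t²) dt` (disc areas);
* the pointwise facts `0 ≤ 4πK_S ≤ 1/s`, `|4πK_S - 1/s| ≤ 3/(2S)` on `(0, S]` (`ballKernel_nonneg`,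
  `ballKernel_le_inv`, `abs_ballKernel_sub_inv_le`) and `K_S ∈ L¹(B_S)` (`integrableOn_ballKernel`).

The companion file `…CoreContinuationHarmonicMinorant.lean` rotates a general wave vector onto
the axis and proves the per-mode Green identity `|k|²∫_{B_S} cos(k·y)K_S = 1 - ⨍_{B_S} cos(k·y)`
from these by a one-variable integration by parts. Pattern and tools as in
`…CoreDeficitBoundsKernelBall.lean` (truncated Newton kernel) of this route.

## References

* D. Gilbarg, N. S. Trudinger, *Elliptic Partial Differential Equations of Second Order*,
  Springer 2001, §2.5 (Green's function of the ball), (2.10)–(2.17). [GilbargTrudinger2001]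
* E. M. Stein, G. Weiss, *Introduction to Fourier Analysis on Euclidean Spaces*, Ch. IV Thm 3.3
  (Fourier transforms of radial functions; here avoided by slicing).
-/

noncomputable section

open MeasureTheory Set Real Metric
open scoped BigOperators RealInnerProductSpace

namespace Summit.AtomisticToContinuum.BoseEinsteinCondensation.Theorems.CoreContinuationKernel

open Literature.Analysis.FluidPDE
open Literature.MathematicalPhysics.QuantumManyBody.BoseGas (Space)
open Summit.AtomisticToContinuum.BoseEinsteinCondensation.Theorems.CoreDeficitBounds

/-! ### The radial integral of the horizontal slice of the ball kernel -/

/-- **The radial integral of the horizontal slice of the ball kernel** (without the factor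
`(4π)⁻¹`): for `S > 0` and a height `t`,
`∫₀^∞ ρ [ρ² < S² - t²] (1/√(ρ²+t²) - 3/(2S) + (ρ²+t²)/(2S³)) dρ
  = [t² < S²] ((S - |t|) - (3/(4S))(S² - t²) + (S⁴ - t⁴)/(8S³))`
(the antiderivative is `√(ρ²+t²) - 3(ρ²+t²)/(4S) + (ρ²+t²)²/(8S³)`). [folklore] -/
theorem integral_radial_slice_ballKernel {S : ℝ} (hS : 0 < S) (t : ℝ) :
    ∫ ρ in Ioi (0 : ℝ), ρ * (if ρ ^ 2 < S ^ 2 - t ^ 2 then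
        ((Real.sqrt (ρ ^ 2 + t ^ 2))⁻¹ - 3 / (2 * S) + (ρ ^ 2 + t ^ 2) / (2 * S ^ 3)) else 0) =
      if t ^ 2 < S ^ 2 then
        (S - |t|) - 3 / (4 * S) * (S ^ 2 - t ^ 2) + (S ^ 4 - t ^ 4) / (8 * S ^ 3) else 0 := by
  by_cases ht : t ^ 2 < S ^ 2
  · rw [if_pos ht]
    set ρ₀ : ℝ := Real.sqrt (S ^ 2 - t ^ 2) with hρ₀
    have hρ₀pos : 0 < ρ₀ := Real.sqrt_pos.2 (by linarith)
    have hρ₀sq : ρ₀ ^ 2 = S ^ 2 - t ^ 2 := Real.sq_sqrt (by linarith)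
    -- restrict to `(0, ρ₀)`
    have hcongr : ∀ ρ ∈ Ioi (0 : ℝ),
        ρ * (if ρ ^ 2 < S ^ 2 - t ^ 2 then
          ((Real.sqrt (ρ ^ 2 + t ^ 2))⁻¹ - 3 / (2 * S) + (ρ ^ 2 + t ^ 2) / (2 * S ^ 3)) else 0) =
          (Iio ρ₀).indicator (fun ρ => ρ * ((Real.sqrt (ρ ^ 2 + t ^ 2))⁻¹ - 3 / (2 * S) +
            (ρ ^ 2 + t ^ 2) / (2 * S ^ 3))) ρ := by
      intro ρ hρ
      rw [mem_Ioi] at hρ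
      by_cases h : ρ < ρ₀
      · rw [indicator_of_mem (mem_Iio.2 h), if_pos]
        rw [← hρ₀sq]
        exact pow_lt_pow_left₀ h hρ.le two_ne_zero
      · rw [indicator_of_notMem (by rwa [mem_Iio]), if_neg, mul_zero]
        rw [← hρ₀sq, not_lt]
        exact pow_le_pow_left₀ hρ₀pos.le (not_lt.1 h) 2
    rw [setIntegral_congr_fun measurableSet_Ioi hcongr, setIntegral_indicator measurableSet_Iio,
      Ioi_inter_Iio, ← integral_Ioc_eq_integral_Ioo, ← intervalIntegral.integral_of_le hρ₀pos.le]
    -- fundamental theorem of calculus on `(0, ρ₀)` with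
    -- `F(ρ) = √(ρ²+t²) - 3(ρ²+t²)/(4S) + (ρ²+t²)²/(8S³)`
    have hderiv : ∀ ρ ∈ Ioo (0 : ℝ) ρ₀,
        HasDerivAt (fun ρ => Real.sqrt (ρ ^ 2 + t ^ 2) - 3 * (ρ ^ 2 + t ^ 2) / (4 * S) +
            (ρ ^ 2 + t ^ 2) ^ 2 / (8 * S ^ 3))
          (ρ * ((Real.sqrt (ρ ^ 2 + t ^ 2))⁻¹ - 3 / (2 * S) + (ρ ^ 2 + t ^ 2) / (2 * S ^ 3))) ρ := by
      intro ρ hρ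
      have hpos : 0 < ρ ^ 2 + t ^ 2 := by nlinarith [hρ.1]
      have h1 : HasDerivAt (fun ρ : ℝ => ρ ^ 2 + t ^ 2) (2 * ρ) ρ := by
        simpa using (hasDerivAt_pow 2 ρ).add_const (t ^ 2)
      have h2 := h1.sqrt hpos.ne'
      have h3 : HasDerivAt (fun ρ : ℝ => 3 * (ρ ^ 2 + t ^ 2) / (4 * S)) (3 * (2 * ρ) / (4 * S)) ρ :=
        (h1.const_mul 3).div_const _
      have h4 : HasDerivAt (fun ρ : ℝ => (ρ ^ 2 + t ^ 2) ^ 2 / (8 * S ^ 3))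
          (((2 : ℕ) : ℝ) * (ρ ^ 2 + t ^ 2) ^ (2 - 1) * (2 * ρ) / (8 * S ^ 3)) ρ :=
        (h1.pow 2).div_const (8 * S ^ 3)
      refine ((h2.sub h3).add h4).congr_deriv ?_
      have hs : Real.sqrt (ρ ^ 2 + t ^ 2) ≠ 0 := (Real.sqrt_pos.2 hpos).ne'
      simp only [Nat.cast_ofNat, pow_one, show (2 : ℕ) - 1 = 1 from rfl]
      field_simp
      ring
    have hcont : ContinuousOn (fun ρ : ℝ => Real.sqrt (ρ ^ 2 + t ^ 2) -
        3 * (ρ ^ 2 + t ^ 2) / (4 * S) + (ρ ^ 2 + t ^ 2) ^ 2 / (8 * S ^ 3)) (Icc 0 ρ₀) := by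
      fun_prop
    have hint : IntervalIntegrable (fun ρ : ℝ => ρ * ((Real.sqrt (ρ ^ 2 + t ^ 2))⁻¹ -
        3 / (2 * S) + (ρ ^ 2 + t ^ 2) / (2 * S ^ 3))) volume 0 ρ₀ := by
      have hsplit : (fun ρ : ℝ => ρ * ((Real.sqrt (ρ ^ 2 + t ^ 2))⁻¹ -
          3 / (2 * S) + (ρ ^ 2 + t ^ 2) / (2 * S ^ 3))) = fun ρ =>
          ρ * (Real.sqrt (ρ ^ 2 + t ^ 2))⁻¹ + ρ * (-(3 / (2 * S)) + (ρ ^ 2 + t ^ 2) / (2 * S ^ 3)) := by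
        funext ρ; ring
      rw [hsplit]
      refine IntervalIntegrable.add ?_ (Continuous.intervalIntegrable (by fun_prop) _ _)
      refine (intervalIntegrable_const (c := (1 : ℝ))).mono_fun' ?_ ?_
      · exact ((measurable_id.mul ((measurable_id.pow_const 2).add_const _).sqrt.inv)).aestronglyMeasurable
      · refine Filter.Eventually.of_forall fun ρ => ?_
        show ‖ρ * (Real.sqrt (ρ ^ 2 + t ^ 2))⁻¹‖ ≤ 1
        rw [Real.norm_eq_abs, abs_mul, abs_inv]
        rcases eq_or_ne (Real.sqrt (ρ ^ 2 + t ^ 2)) 0 with h0 | h0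
        · rw [h0]; simp
        · have hs : |ρ| ≤ |Real.sqrt (ρ ^ 2 + t ^ 2)| := by
            rw [abs_of_nonneg (Real.sqrt_nonneg _), ← Real.sqrt_sq_eq_abs]
            exact Real.sqrt_le_sqrt (by nlinarith)
          rw [mul_inv_le_iff₀ (abs_pos.2 h0), one_mul]
          exact hs
    rw [intervalIntegral.integral_eq_sub_of_hasDerivAt_of_le hρ₀pos.le hcont hderiv hint]
    have hS0 : S ≠ 0 := hS.ne'
    rw [hρ₀sq, sub_add_cancel, Real.sqrt_sq hS.le, show (0 : ℝ) ^ 2 + t ^ 2 = t ^ 2 by ring,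
      Real.sqrt_sq_eq_abs]
    field_simp
    ring
  · rw [if_neg ht]
    refine setIntegral_eq_zero_of_forall_eq_zero fun ρ _ => ?_
    rw [if_neg, mul_zero]
    nlinarith [sq_nonneg ρ, not_lt.1 ht]

/-- **The radial integral of the horizontal slice of the ball indicator**:
`∫₀^∞ ρ [ρ² < S² - t²] dρ = [t² < S²] (S² - t²)/2`. [folklore] -/
theorem integral_radial_slice_one (S t : ℝ) :
    ∫ ρ in Ioi (0 : ℝ), ρ * (if ρ ^ 2 < S ^ 2 - t ^ 2 then (1 : ℝ) else 0) =
      if t ^ 2 < S ^ 2 then (S ^ 2 - t ^ 2) / 2 else 0 := by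
  by_cases ht : t ^ 2 < S ^ 2
  · rw [if_pos ht]
    set ρ₀ : ℝ := Real.sqrt (S ^ 2 - t ^ 2) with hρ₀
    have hρ₀pos : 0 < ρ₀ := Real.sqrt_pos.2 (by linarith)
    have hρ₀sq : ρ₀ ^ 2 = S ^ 2 - t ^ 2 := Real.sq_sqrt (by linarith)
    have hcongr : ∀ ρ ∈ Ioi (0 : ℝ),
        ρ * (if ρ ^ 2 < S ^ 2 - t ^ 2 then (1 : ℝ) else 0) = (Iio ρ₀).indicator (fun ρ => ρ) ρ := by
      intro ρ hρ
      rw [mem_Ioi] at hρ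
      by_cases h : ρ < ρ₀
      · rw [indicator_of_mem (mem_Iio.2 h), if_pos, mul_one]
        rw [← hρ₀sq]
        exact pow_lt_pow_left₀ h hρ.le two_ne_zero
      · rw [indicator_of_notMem (by rwa [mem_Iio]), if_neg, mul_zero]
        rw [← hρ₀sq, not_lt]
        exact pow_le_pow_left₀ hρ₀pos.le (not_lt.1 h) 2
    rw [setIntegral_congr_fun measurableSet_Ioi hcongr, setIntegral_indicator measurableSet_Iio,
      Ioi_inter_Iio, ← integral_Ioc_eq_integral_Ioo, ← intervalIntegral.integral_of_le hρ₀pos.le,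
      integral_id, hρ₀sq]
    ring
  · rw [if_neg ht]
    refine setIntegral_eq_zero_of_forall_eq_zero fun ρ _ => ?_
    rw [if_neg, mul_zero]
    nlinarith [sq_nonneg ρ, not_lt.1 ht]

/-! ### The horizontal slices -/

/-- `t² < S² ↔ t ∈ (-S, S)` for `S ≥ 0`. [folklore] -/
theorem sq_lt_sq_iff_mem_Ioo' {S : ℝ} (hS : 0 ≤ S) (t : ℝ) : t ^ 2 < S ^ 2 ↔ t ∈ Ioo (-S) S := by
  rw [sq_lt_sq, abs_of_nonneg hS, abs_lt, mem_Ioo]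

/-- **The horizontal slice of the ball kernel** (without the factor `(4π)⁻¹`): for fixed height
`t`, `∫_{ℝ²} [‖(w,t)‖ < S] cos(κt) (1/‖(w,t)‖ - 3/(2S) + ‖(w,t)‖²/(2S³)) dw =
2π cos(κt) [t² < S²] ((S - |t|) - (3/(4S))(S² - t²) + (S⁴ - t⁴)/(8S³))`. [folklore] -/
theorem integral_slice_ballKernel {S : ℝ} (hS : 0 < S) (κ t : ℝ) :
    ∫ w : EuclideanSpace ℝ (Fin 2), (ball (0 : Space) S).indicator
        (fun z => Real.cos (κ * z 2) * (‖z‖⁻¹ - 3 / (2 * S) + ‖z‖ ^ 2 / (2 * S ^ 3)))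
          (cylSplit.symm (t, w)) =
      radialConst₂ * (Real.cos (κ * t) * (if t ^ 2 < S ^ 2 then
        (S - |t|) - 3 / (4 * S) * (S ^ 2 - t ^ 2) + (S ^ 4 - t ^ 4) / (8 * S ^ 3) else 0)) := by
  set h : ℝ → ℝ := fun ρ => if ρ ^ 2 < S ^ 2 - t ^ 2 then
      ((Real.sqrt (ρ ^ 2 + t ^ 2))⁻¹ - 3 / (2 * S) + (ρ ^ 2 + t ^ 2) / (2 * S ^ 3)) else 0 with hh
  have hpt : ∀ w : EuclideanSpace ℝ (Fin 2), (ball (0 : Space) S).indicator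
      (fun z => Real.cos (κ * z 2) * (‖z‖⁻¹ - 3 / (2 * S) + ‖z‖ ^ 2 / (2 * S ^ 3)))
        (cylSplit.symm (t, w)) = Real.cos (κ * t) * h ‖w‖ := by
    intro w
    have hmem : cylSplit.symm (t, w) ∈ ball (0 : Space) S ↔ ‖w‖ ^ 2 < S ^ 2 - t ^ 2 := by
      rw [mem_ball_zero_iff, ← sq_lt_sq₀ (norm_nonneg _) hS.le, norm_sq_cylSplit_symm]
      constructor <;> intro h' <;> linarith
    by_cases hw : ‖w‖ ^ 2 < S ^ 2 - t ^ 2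
    · rw [indicator_of_mem (hmem.2 hw), hh]
      simp only
      rw [if_pos hw, cylSplit_symm_apply_two, norm_sq_cylSplit_symm, norm_cylSplit_symm]
    · rw [indicator_of_notMem (fun h' => hw (hmem.1 h')), hh]
      simp only
      rw [if_neg hw, mul_zero]
  simp_rw [hpt]
  rw [MeasureTheory.integral_const_mul, integral_fun_norm_two h, smul_eq_mul]
  simp_rw [smul_eq_mul]
  rw [integral_radial_slice_ballKernel hS t]
  ring

/-- **The horizontal slice of the ball indicator**: for fixed height `t`,
`∫_{ℝ²} [‖(w,t)‖ < S] cos(κt) dw = 2π cos(κt) [t² < S²] (S² - t²)/2`. [folklore] -/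
theorem integral_slice_one {S : ℝ} (hS : 0 < S) (κ t : ℝ) :
    ∫ w : EuclideanSpace ℝ (Fin 2), (ball (0 : Space) S).indicator
        (fun z => Real.cos (κ * z 2)) (cylSplit.symm (t, w)) =
      radialConst₂ * (Real.cos (κ * t) * (if t ^ 2 < S ^ 2 then (S ^ 2 - t ^ 2) / 2 else 0)) := by
  set h : ℝ → ℝ := fun ρ => if ρ ^ 2 < S ^ 2 - t ^ 2 then (1 : ℝ) else 0 with hh
  have hpt : ∀ w : EuclideanSpace ℝ (Fin 2), (ball (0 : Space) S).indicator
      (fun z => Real.cos (κ * z 2)) (cylSplit.symm (t, w)) = Real.cos (κ * t) * h ‖w‖ := by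
    intro w
    have hmem : cylSplit.symm (t, w) ∈ ball (0 : Space) S ↔ ‖w‖ ^ 2 < S ^ 2 - t ^ 2 := by
      rw [mem_ball_zero_iff, ← sq_lt_sq₀ (norm_nonneg _) hS.le, norm_sq_cylSplit_symm]
      constructor <;> intro h' <;> linarith
    by_cases hw : ‖w‖ ^ 2 < S ^ 2 - t ^ 2
    · rw [indicator_of_mem (hmem.2 hw), hh]
      simp only
      rw [if_pos hw, cylSplit_symm_apply_two, mul_one]
    · rw [indicator_of_notMem (fun h' => hw (hmem.1 h')), hh]
      simp only
      rw [if_neg hw, mul_zero]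
  simp_rw [hpt]
  rw [MeasureTheory.integral_const_mul, integral_fun_norm_two h, smul_eq_mul]
  simp_rw [smul_eq_mul]
  rw [integral_radial_slice_one S t]
  ring

/-! ### The axial ball integrals -/

/-- The integrand of the ball kernel against an axial plane wave is measurable. [folklore] -/
theorem measurable_cos_axial_mul_ballKernel (κ S : ℝ) : Measurable fun z : Space =>
    Real.cos (κ * z 2) * (‖z‖⁻¹ - 3 / (2 * S) + ‖z‖ ^ 2 / (2 * S ^ 3)) :=
  (Real.continuous_cos.measurable.comp (measurable_const.mul
    (PiLp.continuous_apply 2 (fun _ : Fin 3 => ℝ) 2).measurable)).mul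
    ((continuous_norm.measurable.inv.sub measurable_const).add
      ((continuous_norm.measurable.pow_const 2).div_const _))

/-- The ball kernel against an axial plane wave is integrable on the ball (it is dominated by
`1/‖z‖ + 2/S`). [folklore] -/
theorem integrableOn_cos_axial_mul_ballKernel (κ : ℝ) {S : ℝ} (hS : 0 < S) :
    IntegrableOn (fun z : Space => Real.cos (κ * z 2) * (‖z‖⁻¹ - 3 / (2 * S) + ‖z‖ ^ 2 / (2 * S ^ 3)))
      (ball 0 S) := by
  have h1 : IntegrableOn (fun z : Space => ‖z‖⁻¹ + 2 / S) (ball 0 S) :=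
    (integrableOn_inv_norm_ball S).add (integrableOn_const (measure_ball_lt_top.ne))
  refine Integrable.mono' h1 (measurable_cos_axial_mul_ballKernel κ S).aestronglyMeasurable ?_
  rw [ae_restrict_iff' measurableSet_ball]
  refine Filter.Eventually.of_forall fun z hz => ?_
  rw [mem_ball_zero_iff] at hz
  have hn : 0 ≤ ‖z‖ := norm_nonneg z
  have hz2 : ‖z‖ ^ 2 / (2 * S ^ 3) ≤ 1 / (2 * S) := by
    rw [div_le_div_iff₀ (by positivity) (by positivity)]
    have : ‖z‖ ^ 2 ≤ S ^ 2 := pow_le_pow_left₀ hn hz.le 2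
    nlinarith
  rw [Real.norm_eq_abs, abs_mul]
  calc |Real.cos (κ * z 2)| * |‖z‖⁻¹ - 3 / (2 * S) + ‖z‖ ^ 2 / (2 * S ^ 3)|
      ≤ 1 * (‖z‖⁻¹ + 3 / (2 * S) + ‖z‖ ^ 2 / (2 * S ^ 3)) := by
        refine mul_le_mul (Real.abs_cos_le_one _) ?_ (abs_nonneg _) zero_le_one
        refine (abs_add_le _ _).trans (add_le_add ((abs_sub _ _).trans (le_of_eq ?_))
          (le_of_eq (abs_of_nonneg (by positivity))))
        rw [abs_of_nonneg (inv_nonneg.2 hn), abs_of_nonneg (by positivity)]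
    _ ≤ ‖z‖⁻¹ + 2 / S := by
        rw [one_mul]
        have : 3 / (2 * S) + 1 / (2 * S) = 2 / S := by field_simp; norm_num
        linarith

/-- **The ball kernel against an axial plane wave, as an axial integral**:
`∫_{B(0,S)} cos(κ z₂)(1/‖z‖ - 3/(2S) + ‖z‖²/(2S³)) dz
  = 2π ∫_{-S}^{S} cos(κt) ((S - |t|) - (3/(4S))(S² - t²) + (S⁴ - t⁴)/(8S³)) dt`. [folklore] -/
theorem integral_ball_cos_axial_mul_ballKernel (κ : ℝ) {S : ℝ} (hS : 0 < S) :
    ∫ z in ball (0 : Space) S, Real.cos (κ * z 2) * (‖z‖⁻¹ - 3 / (2 * S) + ‖z‖ ^ 2 / (2 * S ^ 3)) =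
      2 * π * ∫ t in (-S)..S, Real.cos (κ * t) *
        ((S - |t|) - 3 / (4 * S) * (S ^ 2 - t ^ 2) + (S ^ 4 - t ^ 4) / (8 * S ^ 3)) := by
  have hint := integrableOn_cos_axial_mul_ballKernel κ hS
  rw [← MeasureTheory.integral_indicator measurableSet_ball,
    integral_eq_integral_integral_cylSplit (hint.integrable_indicator measurableSet_ball)]
  simp_rw [integral_slice_ballKernel hS κ]
  rw [MeasureTheory.integral_const_mul, radialConst₂_eq]
  congr 1
  have hind : (fun t : ℝ => Real.cos (κ * t) * (if t ^ 2 < S ^ 2 then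
      (S - |t|) - 3 / (4 * S) * (S ^ 2 - t ^ 2) + (S ^ 4 - t ^ 4) / (8 * S ^ 3) else 0)) =
      (Ioo (-S) S).indicator fun t => Real.cos (κ * t) *
        ((S - |t|) - 3 / (4 * S) * (S ^ 2 - t ^ 2) + (S ^ 4 - t ^ 4) / (8 * S ^ 3)) := by
    funext t
    by_cases ht : t ^ 2 < S ^ 2
    · rw [if_pos ht, indicator_of_mem ((sq_lt_sq_iff_mem_Ioo' hS.le t).1 ht)]
    · rw [if_neg ht, mul_zero, indicator_of_notMem (fun h => ht ((sq_lt_sq_iff_mem_Ioo' hS.le t).2 h))]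
  rw [hind, MeasureTheory.integral_indicator measurableSet_Ioo, ← integral_Ioc_eq_integral_Ioo,
    ← intervalIntegral.integral_of_le (by linarith : -S ≤ S)]

/-- **The ball multiplier against an axial plane wave, as an axial integral**:
`∫_{B(0,S)} cos(κ z₂) dz = ∫_{-S}^{S} cos(κt) π(S² - t²) dt`. [folklore] -/
theorem integral_ball_cos_axial (κ : ℝ) {S : ℝ} (hS : 0 < S) :
    ∫ z in ball (0 : Space) S, Real.cos (κ * z 2) =
      ∫ t in (-S)..S, Real.cos (κ * t) * (π * (S ^ 2 - t ^ 2)) := by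
  have hc : Continuous fun z : Space => Real.cos (κ * z 2) :=
    Real.continuous_cos.comp (continuous_const.mul (PiLp.continuous_apply 2 _ 2))
  have hint : IntegrableOn (fun z : Space => Real.cos (κ * z 2)) (ball 0 S) :=
    (hc.continuousOn.integrableOn_compact (isCompact_closedBall 0 S)).mono_set ball_subset_closedBall
  rw [← MeasureTheory.integral_indicator measurableSet_ball,
    integral_eq_integral_integral_cylSplit (hint.integrable_indicator measurableSet_ball)]
  simp_rw [integral_slice_one hS κ]
  rw [MeasureTheory.integral_const_mul, radialConst₂_eq]
  have hind : (fun t : ℝ => Real.cos (κ * t) * (if t ^ 2 < S ^ 2 then (S ^ 2 - t ^ 2) / 2 else 0)) =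
      (Ioo (-S) S).indicator fun t => Real.cos (κ * t) * ((S ^ 2 - t ^ 2) / 2) := by
    funext t
    by_cases ht : t ^ 2 < S ^ 2
    · rw [if_pos ht, indicator_of_mem ((sq_lt_sq_iff_mem_Ioo' hS.le t).1 ht)]
    · rw [if_neg ht, mul_zero, indicator_of_notMem (fun h => ht ((sq_lt_sq_iff_mem_Ioo' hS.le t).2 h))]
  rw [hind, MeasureTheory.integral_indicator measurableSet_Ioo, ← integral_Ioc_eq_integral_Ioo,
    ← intervalIntegral.integral_of_le (by linarith : -S ≤ S), ← intervalIntegral.integral_const_mul]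
  refine intervalIntegral.integral_congr fun t _ => ?_
  ring

/-! ### Pointwise facts on the ball kernel -/

/-- **Positivity of the ball Green kernel**: `0 ≤ 1/s - 3/(2S) + s²/(2S³)` for `0 < s ≤ S`
(`2S³ - 3S²s + s³ = (S - s)²(2S + s)`). [folklore] -/
theorem ballKernel_nonneg {S s : ℝ} (hs : 0 < s) (hsS : s ≤ S) :
    0 ≤ s⁻¹ - 3 / (2 * S) + s ^ 2 / (2 * S ^ 3) := by
  have hS : 0 < S := hs.trans_le hsS
  have key : s⁻¹ - 3 / (2 * S) + s ^ 2 / (2 * S ^ 3) = (S - s) ^ 2 * (2 * S + s) / (2 * S ^ 3 * s) := by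
    field_simp
    ring
  rw [key]
  positivity

/-- **Newton domination**: `1/s - 3/(2S) + s²/(2S³) ≤ 1/s` for `0 ≤ s ≤ S`, `0 < S`. [folklore] -/
theorem ballKernel_le_inv {S s : ℝ} (hS : 0 < S) (hs : 0 ≤ s) (hsS : s ≤ S) :
    s⁻¹ - 3 / (2 * S) + s ^ 2 / (2 * S ^ 3) ≤ s⁻¹ := by
  have h1 : s ^ 2 / (2 * S ^ 3) ≤ 3 / (2 * S) := by
    rw [div_le_div_iff₀ (by positivity) (by positivity)]
    have : s ^ 2 ≤ S ^ 2 := pow_le_pow_left₀ hs hsS 2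
    nlinarith
  linarith

/-- **The kernel is the Newton kernel up to `3/(2S)` on the ball**:
`|(1/s - 3/(2S) + s²/(2S³)) - 1/s| ≤ 3/(2S)` for `0 ≤ s ≤ S`, `0 < S`. [folklore] -/
theorem abs_ballKernel_sub_inv_le {S s : ℝ} (hS : 0 < S) (hs : 0 ≤ s) (hsS : s ≤ S) :
    |(s⁻¹ - 3 / (2 * S) + s ^ 2 / (2 * S ^ 3)) - s⁻¹| ≤ 3 / (2 * S) := by
  have h1 : s ^ 2 / (2 * S ^ 3) ≤ 3 / (2 * S) := by
    rw [div_le_div_iff₀ (by positivity) (by positivity)]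
    have : s ^ 2 ≤ S ^ 2 := pow_le_pow_left₀ hs hsS 2
    nlinarith
  have h2 : 0 ≤ s ^ 2 / (2 * S ^ 3) := by positivity
  rw [abs_le]
  constructor <;> linarith

/-- The ball kernel is measurable. [folklore] -/
theorem measurable_ballKernel (S : ℝ) :
    Measurable fun y : Space => ‖y‖⁻¹ - 3 / (2 * S) + ‖y‖ ^ 2 / (2 * S ^ 3) :=
  (continuous_norm.measurable.inv.sub measurable_const).add
    ((continuous_norm.measurable.pow_const 2).div_const _)

/-- **The ball kernel is integrable on the ball** (dominated by `1/‖y‖ + 2/S`). [folklore] -/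
theorem integrableOn_ballKernel {S : ℝ} (hS : 0 < S) :
    IntegrableOn (fun y : Space => ‖y‖⁻¹ - 3 / (2 * S) + ‖y‖ ^ 2 / (2 * S ^ 3)) (ball 0 S) := by
  have h := integrableOn_cos_axial_mul_ballKernel 0 hS
  refine h.congr_fun (fun y _ => ?_) measurableSet_ball
  simp

end Summit.AtomisticToContinuum.BoseEinsteinCondensation.Theorems.CoreContinuationKernel

end
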